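import Mathlib.Topology.KrullDimension
import Mathlib.Topology.Sober
import Mathlib.Order.KrullDimension
import HarnessLib

/-!
# Dimension drop along closed subsets missing generic points

Elementary topological dimension theory (Krull dimension of a topological space = supremum of
lengths of chains of irreducible closed subsets, Mathlib `topologicalKrullDim`) for sober `T₀` spaces,
phrased through the specialisation order (Mathlib `specializationOrder`: `x ≤ y ↔ y ⤳ x`, under
which `topologicalKrullDim X = Order.krullDim X`, Mathlib `irreducibleSetEquivPoints`):

* `topologicalKrullDim_lt_of_forall_exists_specializes` — **dimension drop**: if `Z' ⊆ Z` are closed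
  subsets of a sober `T₀` space and every point of `Z'` is a proper specialisation of a point of
  `Z ∖ Z'` (e.g. `Z'` contains no generic point of an irreducible component of `Z`), then
  `dim Z < k + 1 ⇒ dim Z' < k`; in particular (`eq_empty_of_topologicalKrullDim_lt_zero`) after
  `dim Z + 1` such steps nothing is left. This is the counting behind systems of parameters /
  Noether normalisation by successive hypersurface sections (Görtz–Wedhorn I, Lemma 5.34-type
  statements: for `Z` irreducible and `f` not vanishing on `Z`, `dim (Z ∩ V(f)) ≤ dim Z - 1`).
* `topologicalKrullDim_lt_of_isClosed_ssubset` — a proper closed subset of an irreducible sober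
  `T₀` space of dimension `< k + 1` has dimension `< k`.
* `topologicalKrullDim_le_rangeFactorization` — for a continuous map that never identifies a
  point with a proper specialisation of it (e.g. a map with discrete fibres), `dim X ≤ dim f(X)`
  (`f(X)` with the subspace topology; incomparability).

## References

* U. Görtz, T. Wedhorn, *Algebraic Geometry I: Schemes*, 2nd ed. (2020), (5.3)–(5.7): dimension of
  topological spaces via chains of irreducible closed subsets, Lemma 5.7 and Prop. 5.30 ff.
  [GortzWedhorn2020]
-/

open Order TopologicalSpace Topology Set

noncomputable section

namespace Literature.Topology

variable {X Y : Type*} [TopologicalSpace X] [TopologicalSpace Y]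

/-- For a sober `T₀` space the topological Krull dimension is the Krull dimension of its points under
the specialisation order (generic points, Mathlib `irreducibleSetEquivPoints`); the order is
Mathlib's `specializationOrder` (`x ≤ y ↔ y ⤳ x`), taken as an explicit local instance. [folklore] -/
theorem topologicalKrullDim_eq_krullDim [QuasiSober X] [T0Space X] :
    topologicalKrullDim X = @krullDim X (specializationOrder X).toPreorder :=
  letI : PartialOrder X := specializationOrder X
  krullDim_eq_of_orderIso irreducibleSetEquivPoints

/-- A closed subspace of a quasi-sober space is quasi-sober. [folklore] -/
theorem quasiSober_of_isClosed [QuasiSober X] {Z : Set X} (hZ : IsClosed Z) : QuasiSober Z :=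
  hZ.isClosedEmbedding_subtypeVal.quasiSober

/-- **Dimension drop.** Let `Z' ⊆ Z` be closed subsets of a sober `T₀` space such that every point
`z ∈ Z'` is a specialisation of some point `w ∈ Z ∖ Z'`. Then every chain of specialisations in `Z'`
extends by one more point in `Z`, so `dim Z < k + 1` implies `dim Z' < k`. [folklore] -/
theorem topologicalKrullDim_lt_of_forall_exists_specializes [QuasiSober X] [T0Space X]
    {Z Z' : Set X} (hZ : IsClosed Z) (hZ' : IsClosed Z') (hsub : Z' ⊆ Z)
    (h : ∀ z ∈ Z', ∃ w ∈ Z, w ∉ Z' ∧ w ⤳ z) (k : ℕ)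
    (hdim : topologicalKrullDim Z < (k + 1 : ℕ)) : topologicalKrullDim Z' < (k : ℕ) := by
  haveI := quasiSober_of_isClosed hZ
  haveI := quasiSober_of_isClosed hZ'
  letI : PartialOrder Z := specializationOrder Z
  letI : PartialOrder Z' := specializationOrder Z'
  rw [topologicalKrullDim_eq_krullDim, krullDim_lt_coe_iff] at hdim ⊢
  intro l
  -- the inclusion `Z' → Z` is strictly monotone for the specialisation orders
  let ι : Z' → Z := fun z => ⟨z.1, hsub z.2⟩
  have hι : StrictMono ι := by
    intro a b hab
    have hle : ι a ≤ ι b := by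
      change (ι b) ⤳ (ι a)
      exact (subtype_specializes_iff (ι b) (ι a)).2
        ((subtype_specializes_iff b a).1 (show b ⤳ a from hab.le))
    refine lt_of_le_of_ne hle fun heq => hab.ne (Subtype.ext ?_)
    have h1 := congrArg Subtype.val heq
    exact h1
  -- extend `l` by a point of `Z ∖ Z'` generising its top
  obtain ⟨w, hwZ, hwZ', hw⟩ := h (l.last).1 (l.last).2
  have hlt : (l.map ι hι).last < ⟨w, hwZ⟩ := by
    rw [LTSeries.last_map]
    have hle : ι l.last ≤ ⟨w, hwZ⟩ := by
      change (⟨w, hwZ⟩ : Z) ⤳ ι l.last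
      rw [subtype_specializes_iff]
      exact hw
    refine lt_of_le_of_ne hle fun heq => hwZ' ?_
    have : (l.last).1 = w := congrArg Subtype.val heq
    rw [← this]
    exact (l.last).2
  have := hdim ((l.map ι hι).snoc ⟨w, hwZ⟩ hlt)
  simp only [RelSeries.snoc_length, LTSeries.map_length] at this
  omega

/-- A space of topological Krull dimension `< 0` is empty. [folklore] -/
theorem eq_empty_of_topologicalKrullDim_lt_zero [QuasiSober X] [T0Space X] {Z : Set X}
    (hZ : IsClosed Z) (hdim : topologicalKrullDim Z < (0 : ℕ)) : Z = ∅ := by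
  haveI := quasiSober_of_isClosed hZ
  letI : PartialOrder Z := specializationOrder Z
  rw [topologicalKrullDim_eq_krullDim, krullDim_lt_coe_iff] at hdim
  rw [Set.eq_empty_iff_forall_notMem]
  intro z hz
  have := hdim (RelSeries.singleton _ (⟨z, hz⟩ : Z))
  simp at this

/-- **A proper closed subset of an irreducible sober `T₀` space has smaller dimension**: if
`dim X < k + 1` and `W ⊊ X` is closed then `dim W < k` (the generic point of `X` generises every
point of `W` and is not in `W`). [folklore] -/
theorem topologicalKrullDim_lt_of_isClosed_ssubset [QuasiSober X] [T0Space X] [IrreducibleSpace X]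
    {W : Set X} (hW : IsClosed W) (hWX : W ≠ univ) (k : ℕ)
    (hdim : topologicalKrullDim X < (k + 1 : ℕ)) : topologicalKrullDim W < (k : ℕ) := by
  have hξ : genericPoint X ∉ W := fun hmem => hWX (by
    rw [Set.eq_univ_iff_forall]
    intro x
    exact ((genericPoint_spec X).specializes (mem_univ x)).mem_closed hW hmem)
  refine topologicalKrullDim_lt_of_forall_exists_specializes isClosed_univ hW (subset_univ W)
    (fun z _ => ⟨genericPoint X, mem_univ _, hξ, (genericPoint_spec X).specializes (mem_univ z)⟩)
    k ?_
  rwa [IsHomeomorph.topologicalKrullDim_eq _ (Homeomorph.Set.univ X).isHomeomorph]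

/-- **Incomparability for the corestriction to the image**: if a continuous map `f : X → Y` of
sober `T₀` spaces never identifies a point with a proper specialisation of it (`x ⤳ x'`, `f x = f x'`
⇒ `x = x'`; e.g. `f` has discrete fibres), then `dim X ≤ dim f(X)`, the image carrying the subspace
topology. [folklore] -/
theorem topologicalKrullDim_le_rangeFactorization [QuasiSober X] [T0Space X] [QuasiSober Y]
    [T0Space Y] {f : X → Y} (hf : Continuous f) (hrange : IsClosed (range f))
    (hinc : ∀ ⦃a b : X⦄, a ⤳ b → f a = f b → a = b) :
    topologicalKrullDim X ≤ topologicalKrullDim (range f) := by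
  haveI := quasiSober_of_isClosed hrange
  letI : PartialOrder X := specializationOrder X
  letI : PartialOrder (range f) := specializationOrder (range f)
  rw [topologicalKrullDim_eq_krullDim, topologicalKrullDim_eq_krullDim]
  refine krullDim_le_of_strictMono (rangeFactorization f) fun a b hab => ?_
  have hba : b ⤳ a := hab.le
  have hle : rangeFactorization f a ≤ rangeFactorization f b := by
    change rangeFactorization f b ⤳ rangeFactorization f a
    rw [subtype_specializes_iff]
    exact hba.map hf
  refine lt_of_le_of_ne hle fun heq => hab.ne ?_
  have : f b = f a := by
    have := congrArg Subtype.val heq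
    exact this.symm
  exact (hinc hba this).symm

end Literature.Topology

end
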